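import Literature.Analysis.FluidPDE.KNSSDriftConstantMorrey

/-!
# Route HardyPointSink — crux `NoHardyTypeIAncient`, line `birth`: the Hardy-bounded drift is constant

Stub `stub_hardyDriftConstant` of the registered skeleton of line `birth` for the crux
`Summit.NavierStokesRegularity.NavierStokesRegularity.Theses.HardyPointSink.NoHardyTypeIAncient`
(item stmt-NavierStokesRegularity-7980).

Let `(U, b)` be a drift-mild pair on the window `(0, T)` (`IsKNSSDriftMild T N U b`, the output of
Koch–Nadirashvili–Seregin–Šverák 2009, Lemma 3.1) representing a field `u`, `u(t) = U(t) + b(t)`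
a.e. in space for a.e. `t ∈ (0, T)`, and suppose `u` is Hardy-bounded about every centre at a.e.
time, `∫ |u(t, x)|² / |x − x₀| dx ≤ K`. Then the parasitic drift `b` is a.e. equal to a constant.

Proof: the Hardy bound about the ORIGIN alone gives the scale-invariant Morrey bound
`∫_{B_r(0)} |u(t)|² ≤ r ∫_{B_r(0)} |u(t)|² / |x| ≤ K r` at a.e. time
(`setLIntegral_ball_sq_le_of_hardy`), and under that a.e.-in-time Morrey bound the drift of a
drift-mild pair is a.e. constant: this is the tree theorem
`Literature.Analysis.FluidPDE.IsKNSSDriftMild.exists_ae_drift_eq_const_of_morrey`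
(`Literature/Analysis/FluidPDE/KNSSDriftConstantMorrey.lean`; heat-kernel averaging of the
drift-mild identity `u(t) = e^{(t−s)Δ}u(s) − B¹ₛ(u,u)(t) + (b(t) − b(s))` at scale `√ρ → ∞`, after
KNSS 2009, proof of Thm 6.1, last paragraph, arXiv:0709.3599 p. 12). The positivity of `T` in the
registered signature is not needed. [folklore]
-/

open MeasureTheory Set Function Filter TopologicalSpace
open scoped ENNReal NNReal Topology RealInnerProductSpace

set_option linter.dupNamespace false -- nested layout Summit.<S>.<Sub>, Sub = S (D-0017)

namespace Summit.NavierStokesRegularity.NavierStokesRegularity.Theorems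

/-- **Hardy ⇒ Morrey about the origin.** If `∫ ‖f x‖² / ‖x‖ dx ≤ K` on `ℝ³` (as a Lebesgue
integral in `ℝ≥0∞`), then `∫_{B_r(0)} ‖f‖² ≤ K r` for every radius `r`: on the ball
`‖f y‖² ≤ r · ‖f y‖² / ‖y‖`. [folklore] -/
theorem setLIntegral_ball_sq_le_of_hardy {F : Type*} [NormedAddCommGroup F]
    {f : EuclideanSpace ℝ (Fin 3) → F} {K : ℝ≥0} {r : ℝ}
    (hH : ∫⁻ x, ‖f x‖ₑ ^ 2 / ‖x‖ₑ ≤ K) :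
    ∫⁻ y in Metric.ball (0 : EuclideanSpace ℝ (Fin 3)) r, ‖f y‖ₑ ^ 2 ≤
      ENNReal.ofReal ((K : ℝ) * r) := by
  calc ∫⁻ y in Metric.ball (0 : EuclideanSpace ℝ (Fin 3)) r, ‖f y‖ₑ ^ 2
      ≤ ∫⁻ y in Metric.ball (0 : EuclideanSpace ℝ (Fin 3)) r,
          ENNReal.ofReal r * (‖f y‖ₑ ^ 2 / ‖y‖ₑ) := by
        refine setLIntegral_mono' measurableSet_ball fun y hy => ?_
        rcases eq_or_ne (‖f y‖ₑ ^ 2) 0 with h0 | h0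
        · rw [h0]
          exact zero_le
        have hr : ENNReal.ofReal r ≠ 0 := (ENNReal.ofReal_pos.2 (Metric.pos_of_mem_ball hy)).ne'
        have hy' : ‖y‖ₑ ≤ ENNReal.ofReal r := by
          rw [← ofReal_norm]
          exact ENNReal.ofReal_le_ofReal (mem_ball_zero_iff.1 hy).le
        rw [← mul_div_assoc, ENNReal.le_div_iff_mul_le (Or.inr (mul_ne_zero hr h0))
          (Or.inl enorm_ne_top), mul_comm]
        exact mul_le_mul_left hy' _
    _ = ENNReal.ofReal r * ∫⁻ y in Metric.ball (0 : EuclideanSpace ℝ (Fin 3)) r,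
          ‖f y‖ₑ ^ 2 / ‖y‖ₑ := lintegral_const_mul' _ _ ENNReal.ofReal_ne_top
    _ ≤ ENNReal.ofReal r * ∫⁻ y, ‖f y‖ₑ ^ 2 / ‖y‖ₑ :=
        mul_le_mul_right (setLIntegral_le_lintegral _ _) _
    _ ≤ ENNReal.ofReal r * K := mul_le_mul_right hH _
    _ = ENNReal.ofReal ((K : ℝ) * r) := by
        rw [ENNReal.ofReal_mul K.coe_nonneg, ENNReal.ofReal_coe_nnreal, mul_comm]

/-- **Stub `stub_hardyDriftConstant` (Hardy-averaged KNSS Thm 6.1 mildness step).** For a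
drift-mild pair `(U, b)` on `(0, T)` with `u(t) = U(t) + b(t)` a.e. at a.e. `t` and `u`
Hardy-bounded about every centre at a.e. `t`, the drift `b` is a.e. constant. The Hardy bound about
the origin yields the Morrey bound `∫_{B_n(0)} |U(t) + b(t)|² ≤ K n` at a.e. `t`
(`setLIntegral_ball_sq_le_of_hardy`), and the conclusion is
`IsKNSSDriftMild.exists_ae_drift_eq_const_of_morrey` (KNSS 2009, proof of Thm 6.1, last
paragraph, in Morrey-averaged form). [folklore] -/
theorem stub_hardyDriftConstant :
    ∀ (T N : ℝ) (K : ℝ≥0)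
      (u U : ℝ → EuclideanSpace ℝ (Fin 3) → EuclideanSpace ℝ (Fin 3))
      (b : ℝ → EuclideanSpace ℝ (Fin 3)),
      0 < T →
      Literature.Analysis.FluidPDE.IsKNSSDriftMild T N U b →
      (∀ᵐ t ∂(volume.restrict (Ioo (0 : ℝ) T)), u t =ᵐ[volume] fun x => U t x + b t) →
      (∀ x₀ : EuclideanSpace ℝ (Fin 3), ∀ᵐ t ∂(volume.restrict (Ioo (0 : ℝ) T)),
        ∫⁻ x, ‖u t x‖ₑ ^ 2 / ‖x - x₀‖ₑ ≤ K) →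
      ∃ β : EuclideanSpace ℝ (Fin 3), ∀ᵐ t ∂(volume.restrict (Ioo (0 : ℝ) T)), b t = β := by
  intro T N K u U b _ h hrep hH
  -- the Morrey bound about the origin at integer radii, at a.e. time
  have hae : ∀ᵐ σ ∂(volume.restrict (Ioo 0 T)), ∀ n : ℕ, 1 ≤ n →
      ∫⁻ y in Metric.ball (0 : EuclideanSpace ℝ (Fin 3)) n, ‖U σ y + b σ‖ₑ ^ 2 ≤
        ENNReal.ofReal ((K : ℝ) * n) := by
    filter_upwards [hrep, hH 0] with σ hσ hHσ n _
    have h1 : ∫⁻ y in Metric.ball (0 : EuclideanSpace ℝ (Fin 3)) n, ‖U σ y + b σ‖ₑ ^ 2 =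
        ∫⁻ y in Metric.ball (0 : EuclideanSpace ℝ (Fin 3)) n, ‖u σ y‖ₑ ^ 2 := by
      refine lintegral_congr_ae (ae_restrict_of_ae ?_)
      filter_upwards [hσ] with y hy
      rw [hy]
    rw [h1]
    refine setLIntegral_ball_sq_le_of_hardy ?_
    simpa only [sub_zero] using hHσ
  obtain ⟨β, -, hβ⟩ := h.exists_ae_drift_eq_const_of_morrey K.coe_nonneg hae
  exact ⟨β, hβ⟩

end Summit.NavierStokesRegularity.NavierStokesRegularity.Theorems
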